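import Summits.QuantumFields.BalabanUV.Beta.SecondOrderBorderClassKit
import Summits.QuantumFields.BalabanUV.Beta.SecondOrderBorderModel

/-!
# `BalabanUV.Beta.SecondOrderBorderModelClass` — binder row D1, (L4): THE CLASSES OF THE BORDER MODEL (`LocStencil₂`, block translation)
# AND **THE hR END FOR THE WALL LITERAL WITH THE MODEL BORDER TABLE ⟸ THE MIXED LETTER AT LEVEL `0` ONLY**
# (β sub-cell, row BETA-an2 = BINDER-OWNERS row D1 OWNER, lineage an2 gen 20, K-L2 part 3b + K-L3)

HONEST FRAMING (cell charter, verbatim): «discharging BetaPertH makes Balaban's UV stability UNCONDITIONAL — a real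
constructive-QFT result; it is NOT the continuum limit and NOT the Clay problem.»  DERIVED cell leaf ([folklore] kernel bookkeeping + wiring);
no statement of Bałaban's papers, no `[cite:]`, no `Prop` fact; THE MIXED LETTER IS STILL A HYPOTHESIS; instantiates no binder of the wall
BY ITSELF.  NOT D1, NOT `BetaPertH`, NOT continuum, NOT Clay.

WHAT (`d + 1 = 4`, odd `Lc`, centred root `ρ_c`, pins `(cE, cVH) = (Lc⁴, −Lc⁸∕2)`, the END's `γ`/`hγ`, `cB ≠ 0`):
* §1 (generic `d`) block translation of the generator (`ctGen_add_zsmul`) and of the BORDER blocks of `bhKAt` (`bhKAt_inl_inr_add_zsmul`,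
  `bhKAt_inr_inl_add_zsmul` — an1's `linCountAt_add`).
* §2 `locStencil₂_wallD₀` (the level-0 border contact is `LocStencil₂`: `SecondOrderBorderClassKit.locStencil₂_conjW` with
  `locStencil_SpureRecAt`, `decays_bhKAt`, `locStencil_diagK_smul_ctGen`, `locStencil₂_diagK_ctGen_mul_ctGen`), `translate_Bwall`,
  hence **`locStencil₂_vh₂SModel`** (the END's `hB`) and **`vh₂SModel_translate`** (the END's `hBt`).
* §3 **`axisReflectionCovariant_flipK_TbalOf_JsRecWAtOf_of_mixed_letter_model`** (+ `_suN`): an3's level-0 END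
  `SecondOrderLetterLevels.…_of_an1_letters₀` with `vh₂S := vh₂SModel Lc cΛ cB γ` and ALL its border hypotheses DISCHARGED
  (`hB`, `hB0`, `hBat`, `hBmm0`, `hB₀` by `borderAt_zero_vh₂SModel`, `hBt`): **hR for the wall literal with the model border table ⟸ the
  mixed identity (M₀) + the residual `RM₀`'s class/parity + lock2 ONLY.**
HONEST: this discharges the BORDER letter for the literal whose border table IS the model; it does NOT identify the model with Bałaban's
second-order border jet (an1's letter ⟺ `cB•T_an1 − Twall` border-reflection-invariant), and the MIXED letter remains an1's∕an3's.  0∕4 binders.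
Provenance: β sub-cell, unit beta-an2 gen 20, 2026-08-20 (v1); no existing file touched.
-/

open Finset
open scoped BigOperators
open Literature.Probability.LatticeModels (Torus.proj)
open Literature.MathematicalPhysics.QuantumFieldTheory
open Literature.MathematicalPhysics.QuantumFieldTheory.Balaban1983to89
open Literature.MathematicalPhysics.QuantumFieldTheory.Balaban1983to89.Beta
open B12Sec2to5 (l1 l1_nonneg)
open ExpKernelCalculus (MKer Decays BiLoc comp tadpole VertexFamily VertexFamily₂ shiftK)
open AffineAveraging (box toSite)
open AveragingContours (blk off)
open AveragingContoursRooted (ctr ctrOff ctrOff_mem_box linAvgAt)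
open AveragingHessianKernels (Bond Bond.sh off_add_smul blk_add_smul)
open AveragingHessianKernelsRooted (vhSAt hessFFAt linCountAt linKerAt linKerAt_add linCountAt_add)
open AveragingMixedJetTables (mixFFAt)
open PolarizationSign (reflSign AxisReflectionCovariant)
open KernelReflection (refK refK_apply)
open ResolventReflection (bref Φ)
open LatticeForm (quo proj_add_zsmul)
open BlochFibreUniqueness (quo_add_zsmul)
open KKTFluctuationKernel (delta1)
open OneStepResolventKernel (Fib LocStencil JetData wsum)
open OneStepKernelFamily (KInvStep colH vertexOfK TbalOf flipK)
open ColourTrace (Complete TrOrthonormal)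
open WilsonVertex2Sym (wsym22)
open BalabanStepJetsSucc (wE wVH)
open BalabanCompositeJets (LocStencil₂)
open BalabanStepW2 (M2Of wV4 wB2 locStencil₂_smul')
open SecondOrderResponse (LocStencilFM)
open Summit.QuantumFields.BalabanUV.Beta.TameKernelCalculus
open Summit.QuantumFields.BalabanUV.Beta.ChartConjugation (conjV conjW)
open Summit.QuantumFields.BalabanUV.Beta.BorderedHessian (diagK ctGen ctGen_inl ctGen_inr bhKAt bhKAt_inl_inr bhKAt_inr_inl bhKStepAt
  bhKStepAt_zero stepScale sgnK linAvgAt_delta1_eq_cast decays_bhKAt)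
open Summit.QuantumFields.BalabanUV.Beta.SpineRooted (SpureRecAt locStencil_SpureRecAt SpureRecAt_translate JsRecWAtOf M1At)
open Summit.QuantumFields.BalabanUV.Beta.SpineRecursivePureParity (locStencil_diagK_smul_ctGen)
open Summit.QuantumFields.BalabanUV.Beta.SecondOrderZeroCanon (locStencil₂_diagK_ctGen_mul_ctGen)
open Summit.QuantumFields.BalabanUV.Beta.MixedJetTablesPlug (hmix_an1)
open Summit.QuantumFields.BalabanUV.Beta.SecondOrderBorderGauge
open Summit.QuantumFields.BalabanUV.Beta.SecondOrderBorderGaugeWall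
open Summit.QuantumFields.BalabanUV.Beta.SecondOrderBorderCocycle
open Summit.QuantumFields.BalabanUV.Beta.SecondOrderBorderClassKit
open Summit.QuantumFields.BalabanUV.Beta.SecondOrderBorderModel
open Summit.QuantumFields.BalabanUV.Beta.SecondOrderLetterLevels (BorderPrim BorderAt MixedPrim levels border_prim_of_zero
  axisReflectionCovariant_flipK_TbalOf_JsRecWAtOf_of_an1_letters₀ axisReflectionCovariant_flipK_TbalOf_JsRecWAtOf_of_an1_letters₀_suN)

namespace Summit.QuantumFields.BalabanUV.Beta.SecondOrderBorderModelClass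

noncomputable section

variable {d : ℕ}

/-! ## §1 Block translation of the generator and of the border blocks of `bhKAt` -/

/-- [folklore] **THE GENERATOR IS BLOCK-TRANSLATION COVARIANT**: `ctGen α L κ (u + L•t) (x + L•t) a = ctGen α L κ u x a` (`L ≥ 1`). -/
theorem ctGen_add_zsmul {L : ℕ} (hL : 1 ≤ L) (α κ : Fin (d + 1)) (u t x : Fin (d + 1) → ℤ) (a : Fib d) :
    ctGen d α L κ (u + (L : ℤ) • t) (x + (L : ℤ) • t) a = ctGen d α L κ u x a := by
  classical
  rcases a with β | μ
  · rw [ctGen_inl, ctGen_inl]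
    simp only [add_left_inj]
  · rw [ctGen_inr, ctGen_inr, off_add_smul, blk_add_smul hL]
    have e := linKerAt_add (ctr (d + 1) L) L μ (blk L x) t (κ, u)
    rw [show Bond.sh ((κ, u) : Bond (d + 1)) ((L : ℤ) • t) = (κ, u + (L : ℤ) • t) from rfl] at e
    rw [e]

/-- [folklore] **THE FIELD–MULTIPLIER BLOCK OF `bhKAt` IS BLOCK-TRANSLATION INVARIANT** (any root). -/
theorem bhKAt_inl_inr_add_zsmul {N : ℕ} [NeZero N] (ρ : Fin (d + 1) → ℤ) (x y t : Fin (d + 1) → ℤ) (κ l : Fin (d + 1)) :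
    bhKAt d ρ N (x + (N : ℤ) • t) (y + (N : ℤ) • t) (Sum.inl κ) (Sum.inr l) = bhKAt d ρ N x y (Sum.inl κ) (Sum.inr l) := by
  rw [bhKAt_inl_inr, bhKAt_inl_inr, proj_add_zsmul, quo_add_zsmul, linAvgAt_delta1_eq_cast, linAvgAt_delta1_eq_cast]
  have e := linCountAt_add ρ N l (quo N y) t (κ, x)
  rw [show Bond.sh ((κ, x) : Bond (d + 1)) ((N : ℤ) • t) = (κ, x + (N : ℤ) • t) from rfl] at e
  rw [e]

/-- [folklore] **THE MULTIPLIER–FIELD BLOCK OF `bhKAt` IS BLOCK-TRANSLATION INVARIANT** (any root). -/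
theorem bhKAt_inr_inl_add_zsmul {N : ℕ} [NeZero N] (ρ : Fin (d + 1) → ℤ) (x y t : Fin (d + 1) → ℤ) (κ l : Fin (d + 1)) :
    bhKAt d ρ N (x + (N : ℤ) • t) (y + (N : ℤ) • t) (Sum.inr κ) (Sum.inl l) = bhKAt d ρ N x y (Sum.inr κ) (Sum.inl l) := by
  rw [bhKAt_inr_inl, bhKAt_inr_inl, proj_add_zsmul, quo_add_zsmul, linAvgAt_delta1_eq_cast, linAvgAt_delta1_eq_cast]
  have e := linCountAt_add ρ N κ (quo N x) t (l, y)
  rw [show Bond.sh ((l, y) : Bond (d + 1)) ((N : ℤ) • t) = (l, y + (N : ℤ) • t) from rfl] at e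
  rw [e]

/-! ## §2 The classes of the model -/

section Wall

variable {Lc : ℕ} [NeZero Lc]

/-- [folklore] **THE LEVEL-0 BORDER CONTACT IS A `LocStencil₂` FAMILY** (some rate). -/
theorem locStencil₂_wallD₀ (hLc : Odd Lc) (cΛ : ℝ) (γ : ℕ → ℝ) (α : Fin 4) :
    ∃ C δ : ℝ, 0 < δ ∧ LocStencil₂ (wallD₀ Lc cΛ γ α) C δ := by
  obtain ⟨Cs, δ, hδ, hS⟩ := locStencil_SpureRecAt (d := 3) (Lc := Lc) hLc.pos (ctrOff_mem_box hLc.pos) ((Lc : ℝ) ^ 4) (-((Lc : ℝ) ^ 8 / 2)) cΛ 0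
  have h𝕄 := decays_bhKAt (d := 3) (N := Lc) hLc.pos (ctrOff_mem_box hLc.pos) hδ.le
  have hX := locStencil_diagK_smul_ctGen (d := 3) (Lc := Lc) (γ 0) α hδ.le
  have hX₂ := locStencil₂_diagK_ctGen_mul_ctGen (d := 3) α Lc (γ 0 ^ 2) hδ.le
  have e : (fun κ u κ' u' => diagK fun p c => γ 0 * ctGen 3 α Lc κ u p c * (γ 0 * ctGen 3 α Lc κ' u' p c)) =
      fun κ u κ' u' => diagK fun p a => γ 0 ^ 2 * (ctGen 3 α Lc κ u p a * ctGen 3 α Lc κ' u' p a) := by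
    funext κ u κ' u'; congr 1; funext p a; ring
  rw [← e] at hX₂
  obtain ⟨C, hC⟩ := locStencil₂_conjW h𝕄 hS hX hX₂ hδ
  refine ⟨C, δ / 8, by positivity, ?_⟩
  have ew : wallD₀ Lc cΛ γ α = fun κ u κ' u' => conjW (bhKAt 3 (toSite (ctrOff 4 Lc)) Lc)
      (SpureRecAt 3 Lc (toSite (ctrOff 4 Lc)) ((Lc : ℝ) ^ 4) (-((Lc : ℝ) ^ 8 / 2)) cΛ 0 κ u)
      (SpureRecAt 3 Lc (toSite (ctrOff 4 Lc)) ((Lc : ℝ) ^ 4) (-((Lc : ℝ) ^ 8 / 2)) cΛ 0 κ' u')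
      (diagK fun p a => γ 0 * ctGen 3 α Lc κ u p a) (diagK fun p a => γ 0 * ctGen 3 α Lc κ' u' p a)
      (diagK fun p c => γ 0 * ctGen 3 α Lc κ u p c * (γ 0 * ctGen 3 α Lc κ' u' p c)) := rfl
  rw [ew]
  exact hC

/-- [folklore] `Bwall α` is a `LocStencil₂` family. -/
theorem locStencil₂_Bwall (hLc : Odd Lc) (cΛ : ℝ) (γ : ℕ → ℝ) (α : Fin 4) :
    ∃ C δ : ℝ, 0 < δ ∧ LocStencil₂ (Bwall Lc cΛ γ α) C δ := by
  obtain ⟨C, δ, hδ, h⟩ := locStencil₂_wallD₀ hLc cΛ γ α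
  exact ⟨C, δ, hδ, locStencil₂_bdB h⟩

/-- [folklore] The four border parts at ONE common rate (the minimum). -/
theorem locStencil₂_Bwall_common (hLc : Odd Lc) (cΛ : ℝ) (γ : ℕ → ℝ) :
    ∃ δ : ℝ, 0 < δ ∧ ∀ α : Fin 4, ∃ C : ℝ, LocStencil₂ (Bwall Lc cΛ γ α) C δ := by
  choose C δ hδ h using locStencil₂_Bwall hLc cΛ γ
  refine ⟨Finset.univ.inf' Finset.univ_nonempty δ, (Finset.lt_inf'_iff _).2 fun α _ => hδ α, fun α => ⟨|C α|, ?_⟩⟩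
  intro κ u κ' u'
  have hle : Finset.univ.inf' Finset.univ_nonempty δ ≤ δ α := Finset.inf'_le _ (Finset.mem_univ α)
  have h0 : 0 ≤ Finset.univ.inf' Finset.univ_nonempty δ := ((Finset.lt_inf'_iff _).2 fun α _ => hδ α).le
  intro x z a b
  refine (h α κ u κ' u' x z a b).trans ?_
  have hC : C α * Real.exp (-δ α * l1 (u' - u)) ≤ |C α| * Real.exp (-(Finset.univ.inf' Finset.univ_nonempty δ) * l1 (u' - u)) :=
    mul_le_mul (le_abs_self _) (Real.exp_le_exp.2 (by nlinarith [l1_nonneg (u' - u)])) (Real.exp_pos _).le (abs_nonneg _)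
  exact mul_le_mul hC (Real.exp_le_exp.2 (by nlinarith [l1_nonneg (x - u), l1_nonneg (z - u)])) (Real.exp_pos _).le (by positivity)

/-- [folklore] **THE MODEL TABLE `Twall` IS A `LocStencil₂` FAMILY.** -/
theorem locStencil₂_Twall (hLc : Odd Lc) (cΛ : ℝ) (γ : ℕ → ℝ) : ∃ C δ : ℝ, 0 < δ ∧ LocStencil₂ (Twall Lc cΛ γ) C δ := by
  obtain ⟨δ, hδ, h⟩ := locStencil₂_Bwall_common hLc cΛ γ
  obtain ⟨C0, h0⟩ := h 0
  obtain ⟨C1, h1⟩ := h 1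
  obtain ⟨C2, h2⟩ := h 2
  obtain ⟨C3, h3⟩ := h 3
  have hz : LocStencil₂ (0 : Fin 4 → (Fin 4 → ℤ) → Fin 4 → (Fin 4 → ℤ) → MKer 4 (Fib 3)) 0 δ := by
    intro κ u κ' u' x z a b; simp
  have t1 := locStencil₂_stepB hLc.pos 0 h0 hz hδ.le
  have t2 := locStencil₂_stepB hLc.pos 1 h1 t1 hδ.le
  have t3 := locStencil₂_stepB hLc.pos 2 h2 t2 hδ.le
  have t4 := locStencil₂_stepB hLc.pos 3 h3 t3 hδ.le
  exact ⟨_, δ, hδ, t4⟩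

/-- [folklore] **THE MODEL BORDER TABLE IS A `LocStencil₂` FAMILY** (the END's `hB`). -/
theorem locStencil₂_vh₂SModel (hLc : Odd Lc) (cΛ cB : ℝ) (γ : ℕ → ℝ) :
    ∃ C δ : ℝ, 0 < δ ∧ LocStencil₂ (vh₂SModel Lc cΛ cB γ) C δ := by
  obtain ⟨C, δ, hδ, h⟩ := locStencil₂_Twall hLc cΛ γ
  exact ⟨|cB⁻¹| * C, δ, hδ, locStencil₂_smul' cB⁻¹ h⟩

/-- [folklore] **`Bwall α` IS BLOCK-TRANSLATION COVARIANT** (entrywise on the border: `SpureRecAt_translate`, `ctGen_add_zsmul`, §1). -/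
theorem translate_Bwall (hLc : Odd Lc) (cΛ : ℝ) (γ : ℕ → ℝ) (α κ : Fin 4) (u : Fin 4 → ℤ) (κ' : Fin 4) (u' t : Fin 4 → ℤ) :
    Bwall Lc cΛ γ α κ (u + (Lc : ℤ) • t) κ' (u' + (Lc : ℤ) • t) = shiftK (-((Lc : ℤ) • t)) (Bwall Lc cΛ γ α κ u κ' u') := by
  have hS := SpureRecAt_translate (d := 3) (Lc := Lc) (toSite (ctrOff 4 Lc)) hLc.pos ((Lc : ℝ) ^ 4) (-((Lc : ℝ) ^ 8 / 2)) cΛ 0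
  have hg : ∀ (κ : Fin 4) (u x : Fin 4 → ℤ) (a : Fib 3),
      γ 0 * ctGen 3 α Lc κ (u + (Lc : ℤ) • t) x a = γ 0 * ctGen 3 α Lc κ u (x + -((Lc : ℤ) • t)) a := by
    intro κ u x a
    conv_lhs => rw [show x = (x + -((Lc : ℤ) • t)) + (Lc : ℤ) • t by abel]
    rw [ctGen_add_zsmul hLc.pos]
  funext x z a b
  rcases a with β | m <;> rcases b with β' | m'
  · rfl
  · show wallD₀ Lc cΛ γ α κ (u + (Lc : ℤ) • t) κ' (u' + (Lc : ℤ) • t) x z (Sum.inl β) (Sum.inr m') =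
      wallD₀ Lc cΛ γ α κ u κ' u' (x + -((Lc : ℤ) • t)) (z + -((Lc : ℤ) • t)) (Sum.inl β) (Sum.inr m')
    simp only [wallD₀, canonD_apply, hS, ExpKernelCalculus.shiftK, hg, bhKStepAt_zero]
    conv_rhs => rw [show bhKAt 3 (toSite (ctrOff 4 Lc)) Lc (x + -((Lc : ℤ) • t)) (z + -((Lc : ℤ) • t)) (Sum.inl β) (Sum.inr m') =
      bhKAt 3 (toSite (ctrOff 4 Lc)) Lc x z (Sum.inl β) (Sum.inr m') by
        rw [← bhKAt_inl_inr_add_zsmul (toSite (ctrOff 4 Lc)) (x + -((Lc : ℤ) • t)) (z + -((Lc : ℤ) • t)) t β m']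
        simp]
  · show wallD₀ Lc cΛ γ α κ (u + (Lc : ℤ) • t) κ' (u' + (Lc : ℤ) • t) x z (Sum.inr m) (Sum.inl β') =
      wallD₀ Lc cΛ γ α κ u κ' u' (x + -((Lc : ℤ) • t)) (z + -((Lc : ℤ) • t)) (Sum.inr m) (Sum.inl β')
    simp only [wallD₀, canonD_apply, hS, ExpKernelCalculus.shiftK, hg, bhKStepAt_zero]
    conv_rhs => rw [show bhKAt 3 (toSite (ctrOff 4 Lc)) Lc (x + -((Lc : ℤ) • t)) (z + -((Lc : ℤ) • t)) (Sum.inr m) (Sum.inl β') =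
      bhKAt 3 (toSite (ctrOff 4 Lc)) Lc x z (Sum.inr m) (Sum.inl β') by
        rw [← bhKAt_inr_inl_add_zsmul (toSite (ctrOff 4 Lc)) (x + -((Lc : ℤ) • t)) (z + -((Lc : ℤ) • t)) t m β']
        simp]
  · rfl

/-- [folklore] **THE MODEL BORDER TABLE IS BLOCK-TRANSLATION COVARIANT** (the END's `hBt`). -/
theorem vh₂SModel_translate (hLc : Odd Lc) (cΛ cB : ℝ) (γ : ℕ → ℝ) (κ : Fin 4) (u : Fin 4 → ℤ) (κ' : Fin 4) (u' t : Fin 4 → ℤ) :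
    vh₂SModel Lc cΛ cB γ κ (u + (Lc : ℤ) • t) κ' (u' + (Lc : ℤ) • t) = shiftK (-((Lc : ℤ) • t)) (vh₂SModel Lc cΛ cB γ κ u κ' u') := by
  have hB := translate_Bwall hLc cΛ γ
  have hz : ∀ (κ : Fin 4) (u : Fin 4 → ℤ) (κ' : Fin 4) (u' t : Fin 4 → ℤ),
      (0 : Fin 4 → (Fin 4 → ℤ) → Fin 4 → (Fin 4 → ℤ) → MKer 4 (Fib 3)) κ (u + (Lc : ℤ) • t) κ' (u' + (Lc : ℤ) • t) =
        shiftK (-((Lc : ℤ) • t)) ((0 : Fin 4 → (Fin 4 → ℤ) → Fin 4 → (Fin 4 → ℤ) → MKer 4 (Fib 3)) κ u κ' u') := fun _ _ _ _ _ => rfl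
  have t1 := translate_stepB 0 (hB 0) hz
  have t2 := translate_stepB 1 (hB 1) t1
  have t3 := translate_stepB 2 (hB 2) t2
  have t4 := translate_stepB 3 (hB 3) t3
  show cB⁻¹ • Twall Lc cΛ γ κ (u + (Lc : ℤ) • t) κ' (u' + (Lc : ℤ) • t) = shiftK (-((Lc : ℤ) • t)) (cB⁻¹ • Twall Lc cΛ γ κ u κ' u')
  unfold Twall
  rw [t4]
  rfl

/-! ## §3 The hR END for the wall literal with the model border table ⟸ the mixed letter at level `0` only -/

/-- [folklore] **hR(v2.26-W, T := (8N²)⁻¹•wsym22 N, mixFF := mixFFAt ρ_c Lc, vh₂S := vh₂SModel Lc cΛ cB γ) ⟸ THE MIXED IDENTITY (M₀) ONLY**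
(+ the residual `RM₀`'s `LocStencilFM` class and parity, lock2, `cB ≠ 0`): an3's `…_of_an1_letters₀` with every border hypothesis
DISCHARGED by the model (`locStencil₂_vh₂SModel`, `vh₂SModel_inl_inl/_antiTwin/_inr_inr`, `borderAt_zero_vh₂SModel`, `vh₂SModel_translate`). -/
theorem axisReflectionCovariant_flipK_TbalOf_JsRecWAtOf_of_mixed_letter_model (hLc : Odd Lc) {N : ℕ} {C : Type*} [Fintype C]
    [DecidableEq C] {τ : C → Matrix (Fin N) (Fin N) ℂ} (hτ : Complete τ) (ho : TrOrthonormal τ) (hN : N ≠ 0) (c : C) (cΛ cE₂ cB : ℝ)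
    (hcB : cB ≠ 0) (γ : ℕ → ℝ) (hγ : ∀ j, γ j = -((Lc : ℝ) ^ 8 / 2) * wVH 3 Lc j / (stepScale 3 Lc j * (Lc : ℝ) ^ 4))
    (hlock2 : ∀ j, cE₂ * wV4 3 Lc (j + 1) * wVH 3 Lc (j + 1) = ((Lc : ℝ) ^ 4 * wE 3 Lc (j + 1)) ^ 2)
    (RM₀ : Fin 4 → Fin 4 → (Fin 4 → ℤ) → Fin 4 → (Fin 4 → ℤ) → MKer 4 (Fib 3))
    -- (M₀) THE MIXED LETTER AT LEVEL 0, its residual's class and parity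
    (hM₀ : MixedPrim Lc (toSite (ctrOff 4 Lc)) cΛ (mixFFAt (toSite (ctrOff 4 Lc)) Lc) RM₀)
    (hRM₀c : ∀ α : Fin 4, ∃ C δ : ℝ, 0 < δ ∧ LocStencilFM Lc (RM₀ α) C δ)
    (hRM₀p : ∀ (α : Fin 4) κ u ρ w, trK (RM₀ α κ u ρ w) = -sgnK (RM₀ α κ u ρ w)) :
    ∀ j : ℕ, AxisReflectionCovariant
      (flipK (TbalOf Lc (JsRecWAtOf (d := 3) hLc.pos (ctrOff_mem_box hLc.pos) ((Lc : ℝ) ^ 4) (-((Lc : ℝ) ^ 8 / 2)) cΛ cE₂ cB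
        ((8 * (N : ℝ) ^ 2)⁻¹ • wsym22 N) (locStencil₂_vh₂SModel hLc cΛ cB γ) (hmix_an1 (d := 3) hLc.pos (ctrOff_mem_box hLc.pos))) j)) :=
  axisReflectionCovariant_flipK_TbalOf_JsRecWAtOf_of_an1_letters₀ hLc hτ ho hN c cΛ cE₂ cB (locStencil₂_vh₂SModel hLc cΛ cB γ)
    (vh₂SModel_inl_inl cΛ cB γ) γ hγ hlock2 RM₀ hM₀ hRM₀c hRM₀p (vh₂SModel_antiTwin cΛ cB γ) (vh₂SModel_inr_inr cΛ cB γ)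
    (border_prim_of_zero (toSite (ctrOff 4 Lc)) cΛ cB hγ (borderAt_zero_vh₂SModel hLc cΛ cB hcB γ hγ)) (vh₂SModel_translate hLc cΛ cB γ)


/-- [folklore] **THE `SU(N)` INSTANCE, `N ≥ 2`** (colour basis := `ColourBasisSU.suGen N`), with the model border table. -/
theorem axisReflectionCovariant_flipK_TbalOf_JsRecWAtOf_of_mixed_letter_model_suN (hLc : Odd Lc) {N : ℕ} (hN : 2 ≤ N) (cΛ cE₂ cB : ℝ)
    (hcB : cB ≠ 0) (γ : ℕ → ℝ) (hγ : ∀ j, γ j = -((Lc : ℝ) ^ 8 / 2) * wVH 3 Lc j / (stepScale 3 Lc j * (Lc : ℝ) ^ 4))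
    (hlock2 : ∀ j, cE₂ * wV4 3 Lc (j + 1) * wVH 3 Lc (j + 1) = ((Lc : ℝ) ^ 4 * wE 3 Lc (j + 1)) ^ 2)
    (RM₀ : Fin 4 → Fin 4 → (Fin 4 → ℤ) → Fin 4 → (Fin 4 → ℤ) → MKer 4 (Fib 3))
    (hM₀ : MixedPrim Lc (toSite (ctrOff 4 Lc)) cΛ (mixFFAt (toSite (ctrOff 4 Lc)) Lc) RM₀)
    (hRM₀c : ∀ α : Fin 4, ∃ C δ : ℝ, 0 < δ ∧ LocStencilFM Lc (RM₀ α) C δ)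
    (hRM₀p : ∀ (α : Fin 4) κ u ρ w, trK (RM₀ α κ u ρ w) = -sgnK (RM₀ α κ u ρ w)) :
    ∀ j : ℕ, AxisReflectionCovariant
      (flipK (TbalOf Lc (JsRecWAtOf (d := 3) hLc.pos (ctrOff_mem_box hLc.pos) ((Lc : ℝ) ^ 4) (-((Lc : ℝ) ^ 8 / 2)) cΛ cE₂ cB
        ((8 * (N : ℝ) ^ 2)⁻¹ • wsym22 N) (locStencil₂_vh₂SModel hLc cΛ cB γ) (hmix_an1 (d := 3) hLc.pos (ctrOff_mem_box hLc.pos))) j)) :=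
  axisReflectionCovariant_flipK_TbalOf_JsRecWAtOf_of_an1_letters₀_suN hLc hN cΛ cE₂ cB (locStencil₂_vh₂SModel hLc cΛ cB γ)
    (vh₂SModel_inl_inl cΛ cB γ) γ hγ hlock2 RM₀ hM₀ hRM₀c hRM₀p (vh₂SModel_antiTwin cΛ cB γ) (vh₂SModel_inr_inr cΛ cB γ)
    (border_prim_of_zero (toSite (ctrOff 4 Lc)) cΛ cB hγ (borderAt_zero_vh₂SModel hLc cΛ cB hcB γ hγ)) (vh₂SModel_translate hLc cΛ cB γ)

end Wall

end

end Summit.QuantumFields.BalabanUV.Beta.SecondOrderBorderModelClass
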